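import Summits.CriticalPhenomena.PercolationContinuityZ3.Theorems.PercNearOneGluingNoHeavyLowerTailCovTauOfTA
import Summits.CriticalPhenomena.PercolationContinuityZ3.Theorems.PercNearOneGluingNoHeavyLowerTailPostFKG
import HarnessLib

/-!
# `NoHeavyLowerTail` (stmt-CriticalPhenomena-4575) — CONDITIONAL GLUING `COND₃` and KOZMA–NITZAN'S CONJECTURE 1 FOR `|A| ≤ 3`,
# UNCONDITIONALLY (the factory target `TGT-COND3` = `(U_min)₃`, closed)

Support file (prover prim-ineq-prove-1 gen 2, new-inequality factory prove seat; `--supports stmt-CriticalPhenomena-4575`).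
No definitions, no named facts, no sorries.

`TGT-COND3` (harness target of the `NoHeavyLowerTail` inequality factory; kcluster's `(U_min)₃`; this seat's item since gen 1):
   `COND₃ :  μ({o ↮ c} ∩ {o ↔ A}) ≤ μ(o ↔ A) · max_{a ∈ A} μ(a ↮ c)`   for `|A| = 3`,
Kozma–Nitzan's Conjecture 1 (arXiv:2401.12397 p. 3) at `|A| = 3` in the JOINT (post-FKG, `(U_min)`) form, and its literal form
`μ(o ↔ A) · min_a μ(a ↔ c) ≤ μ(o ↔ c)`.  Gen 1 of this seat proved `|A| ≤ 2` (`CondGluing.condGluing_card_le_two`,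
`CondGluing.kozmaNitzan_conjecture1_card_le_two`) and showed that no certificate over the proved quadratic cone exists at `|A| = 3`
(exact pseudo-laws).  The cell then proved the conditioned covariance transfer COV(τ) (prim-hp-8's paper proof; Lean: the
T_A route `CovTau.covTau` of prim-hp-7 / prim-ineq-prove-5 / prim-lit-3, file `…CovTauOfTA.lean`, and the A2/(★_N) route of
prim-hp-4 / prim-gen-induct / prim-ineq-gen-6 / this seat, files `…CovTauA2*`, `…CovTauStarN*`), whence (S5)₂ and (GEN) for three
relays (`CovTau.gen_triple`).  THIS FILE closes the target:
* `CondGluing.condGluing_three` — `COND` for three named relays `a₁, a₂, a₃` ordered by `μ(a_i ↔ c)` ((GEN) at `F = 1{c ∈ ·}`: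
  `Σ_i μ(P_i)·μ(a_i ↔ c) ≤ μ(o ↔ A, o ↔ c)` with the first-reached events `P_i` partitioning `{o ↔ A}`, and `μ(a_i↔c) ≥ μ(a₁↔c)`);
* `CondGluing.condGluing_card_le_three` — **`COND_k` for every `|A| ≤ 3`** at a worst relay, every finite weighted graph;
* `CondGluing.kozmaNitzan_conjecture1_card_le_three` — **Kozma–Nitzan's Conjecture 1 for `|A| ≤ 3`**, in the signature of the
  registered conjecture `Literature.StrongHypotheses.CriticalPhenomena.KozmaNitzan2024_conjecture1` restricted to `A.card ≤ 3`.
[cite: KozmaNitzan2024, Conjecture 1 (p. 3), Theorem 1 (p. 7), Conjecture 4 (p. 32)]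
-/

noncomputable section

namespace Summit.CriticalPhenomena.PercolationContinuityZ3.Theorems

open MeasureTheory Set Literature.Probability.LatticeModels Literature.Probability.Percolation
open scoped Classical BigOperators

namespace CondGluing

/-! ### Three named relays -/

/-- **Conditional gluing for three named relays.**  For relays ordered `μ(a₁↔c) ≤ μ(a₂↔c) ≤ μ(a₃↔c)` (`a₃ ≠ a₁, a₂`), observer
`o`, sink `c`, `U = {o↔a₁} ∪ {o↔a₂} ∪ {o↔a₃}`:  `μ({o↮c} ∩ U) ≤ μ(U) · μ(a₁ ↮ c)`.  Proof: (GEN) for three relays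
(`CovTau.gen_triple`) at `F = 1{c ∈ ·}` gives `Σ_i μ(P_i) μ(a_i↔c) ≤ μ(U ∩ {o↔c})` with `Σ_i μ(P_i) = μ(U)`, and `μ(a_i↔c) ≥ μ(a₁↔c)`.
[cite: KozmaNitzan2024, Conjecture 1 (p. 3), Conjecture 4 (p. 32)] -/
theorem condGluing_three {V : Type*} [Fintype V] (w : Sym2 V → unitInterval) (o c a₁ a₂ a₃ : V) (h31 : a₃ ≠ a₁) (h32 : a₃ ≠ a₂)
    (hm12 : (prodBernoulli w).real (openConn a₁ c) ≤ (prodBernoulli w).real (openConn a₂ c))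
    (hm23 : (prodBernoulli w).real (openConn a₂ c) ≤ (prodBernoulli w).real (openConn a₃ c)) :
    (prodBernoulli w).real ((openConn o c : Set (BondConfig V))ᶜ ∩ (openConn o a₁ ∪ openConn o a₂ ∪ openConn o a₃)) ≤
      (prodBernoulli w).real (openConn o a₁ ∪ openConn o a₂ ∪ openConn o a₃ : Set (BondConfig V)) *
        (prodBernoulli w).real (openConn a₁ c : Set (BondConfig V))ᶜ := by
  classical
  haveI : IsProbabilityMeasure (prodBernoulli w) := inferInstance
  set μ := prodBernoulli w with hμ
  have hmeas : ∀ S : Set (BondConfig V), MeasurableSet S := fun _ => MeasurableSet.of_discrete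
  have hn := fun (S : Set (BondConfig V)) => (measureReal_nonneg : 0 ≤ μ.real S)
  -- the set function `F = 1{c ∈ ·}` (bookkeeping as in `CovTau.kn_conj1_three`)
  set F : Set V → ℝ := fun M => if c ∈ M then 1 else 0 with hF
  have hFmono : ∀ S T : Set V, S ⊆ T → F S ≤ F T := by
    intro S T hST
    simp only [hF]
    by_cases hS : c ∈ S
    · rw [if_pos hS, if_pos (hST hS)]
    · rw [if_neg hS]
      split_ifs <;> norm_num
  have hF0 : ∀ S, 0 ≤ F S := by
    intro S
    simp only [hF]
    split_ifs <;> norm_num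
  have hFind : ∀ x : V, (fun ω : BondConfig V => F (openCluster ω x)) =
      (openConn x c : Set (BondConfig V)).indicator 1 := by
    intro x
    funext ω
    simp only [hF]
    by_cases hω : ω ∈ (openConn x c : Set (BondConfig V))
    · rw [Set.indicator_of_mem hω, Pi.one_apply, if_pos (show c ∈ openCluster ω x from hω)]
    · rw [Set.indicator_of_notMem hω, if_neg (show c ∉ openCluster ω x from hω)]
  have hint : ∀ x : V, ∫ ω, F (openCluster ω x) ∂μ = μ.real (openConn x c) := by
    intro x
    rw [hFind x, integral_indicator_one (hmeas _)]
  have hsetint : ∀ (x : V) (S : Set (BondConfig V)),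
      ∫ ω in S, F (openCluster ω x) ∂μ = μ.real (S ∩ openConn x c : Set (BondConfig V)) := by
    intro x S
    rw [hFind x, ← integral_indicator (hmeas _), Set.indicator_indicator,
      integral_indicator_one ((hmeas _).inter (hmeas _))]
  have key := CovTau.gen_triple w o a₁ a₂ a₃ h31 h32 F hFmono hF0
    (by rw [hint, hint]; exact hm12) (by rw [hint, hint]; exact hm23)
  rw [hint, hint, hint, hsetint] at key
  -- `Σ μ(P_i) = μ(U)`, `μ(Uᶜ-part) = μ(U) − μ(U ∩ {o↔c})`, `μ(a₁↮c) = 1 − μ(a₁↔c)`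
  set U : Set (BondConfig V) := openConn o a₁ ∪ openConn o a₂ ∪ openConn o a₃ with hU
  have hP : μ.real U = μ.real (openConn o a₁) + μ.real (openConn o a₂ ∩ (openConn o a₁)ᶜ : Set (BondConfig V)) +
      μ.real (openConn o a₃ ∩ (openConn o a₁ ∪ openConn o a₂)ᶜ : Set (BondConfig V)) := by
    have h1 : μ.real U = μ.real (U ∩ (openConn o a₁ ∪ openConn o a₂)) +
        μ.real (U \ (openConn o a₁ ∪ openConn o a₂)) :=
      (measureReal_inter_add_sdiff (s := U) (h := measure_ne_top _ _) ((hmeas _).union (hmeas _))).symm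
    have h2 : μ.real (openConn o a₁ ∪ openConn o a₂ : Set (BondConfig V)) =
        μ.real ((openConn o a₁ ∪ openConn o a₂ : Set (BondConfig V)) ∩ openConn o a₁) +
          μ.real ((openConn o a₁ ∪ openConn o a₂ : Set (BondConfig V)) \ openConn o a₁) :=
      (measureReal_inter_add_sdiff (s := (openConn o a₁ ∪ openConn o a₂ : Set (BondConfig V)))
        (h := measure_ne_top _ _) (hmeas _)).symm
    rw [inter_eq_right.2 subset_union_left, hU, Set.union_sdiff_left, Set.sdiff_eq] at h1
    rw [inter_eq_right.2 subset_union_left, Set.union_sdiff_left, Set.sdiff_eq] at h2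
    rw [hU, h1, h2]
  have hsplit : μ.real U = μ.real (U ∩ openConn o c) + μ.real (U \ openConn o c) :=
    (measureReal_inter_add_sdiff (s := U) (h := measure_ne_top _ _) (hmeas _)).symm
  have hcompl : μ.real (openConn a₁ c : Set (BondConfig V))ᶜ = 1 - μ.real (openConn a₁ c : Set (BondConfig V)) :=
    probReal_compl_eq_one_sub (hmeas _)
  have e : ((openConn o c : Set (BondConfig V))ᶜ ∩ U) = U \ openConn o c := by
    rw [Set.inter_comm, Set.sdiff_eq]
  simp only [← hμ] at key
  have hm13 : μ.real (openConn a₁ c) ≤ μ.real (openConn a₃ c) := hm12.trans hm23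
  have hU1 : μ.real (openConn a₁ c) * μ.real U ≤ μ.real (U ∩ openConn o c) := by
    rw [hP]
    nlinarith [key, mul_le_mul_of_nonneg_left hm12 (hn (openConn o a₂ ∩ (openConn o a₁)ᶜ)),
      mul_le_mul_of_nonneg_left hm13 (hn (openConn o a₃ ∩ (openConn o a₁ ∪ openConn o a₂)ᶜ))]
  rw [e, hcompl]
  nlinarith [hsplit, hU1]

/-! ### Every relay set with at most three relays -/

variable {n : ℕ}

/-- The union over a three-element relay set. [folklore] -/
theorem biUnion_openConn_three (o a₁ x y : Fin n) :
    (⋃ a ∈ ({a₁, x, y} : Finset (Fin n)), (openConn o a : Set (BondConfig (Fin n)))) =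
      openConn o a₁ ∪ openConn o x ∪ openConn o y := by
  ext ω
  simp only [Finset.mem_insert, Finset.mem_singleton, Set.mem_iUnion, Set.mem_union, exists_prop]
  constructor
  · rintro ⟨a, (rfl | rfl | rfl), ha⟩
    · exact Or.inl (Or.inl ha)
    · exact Or.inl (Or.inr ha)
    · exact Or.inr ha
  · rintro ((ha | ha) | ha)
    · exact ⟨a₁, Or.inl rfl, ha⟩
    · exact ⟨x, Or.inr (Or.inl rfl), ha⟩
    · exact ⟨y, Or.inr (Or.inr rfl), ha⟩

/-- **Conditional gluing `COND_k` for `|A| ≤ 3` (PROVED).**  For every finite weighted graph, observer `o`, sink `c`, relay set `A`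
with `A.card ≤ 3` and worst relay `a₁ ∈ A` (`μ(a↮c) ≤ μ(a₁↮c)` on `A`):  `μ({o↮c} ∩ {o↔A}) ≤ μ(o↔A) · μ(a₁↮c)` — the factory
target `TGT-COND3` / kcluster's `(U_min)₃`. [cite: KozmaNitzan2024, Conjecture 1 (p. 3), Theorem 1 (p. 7)] -/
theorem condGluing_card_le_three (w : Sym2 (Fin n) → unitInterval) (A : Finset (Fin n)) (o c a₁ : Fin n)
    (hA : A.card ≤ 3) (ha₁ : a₁ ∈ A)
    (hworst : ∀ a ∈ A, (prodBernoulli w).real (openConn a c : Set (BondConfig (Fin n)))ᶜ ≤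
      (prodBernoulli w).real (openConn a₁ c : Set (BondConfig (Fin n)))ᶜ) :
    (prodBernoulli w).real ((openConn o c : Set (BondConfig (Fin n)))ᶜ ∩ ⋃ a ∈ A, openConn o a) ≤
      (prodBernoulli w).real (⋃ a ∈ A, (openConn o a : Set (BondConfig (Fin n)))) *
        (prodBernoulli w).real (openConn a₁ c : Set (BondConfig (Fin n)))ᶜ := by
  by_cases h2 : A.card ≤ 2
  · exact condGluing_card_le_two w A o c a₁ h2 ha₁ hworst
  haveI : IsProbabilityMeasure (prodBernoulli w) := inferInstance
  have hmeas : ∀ S : Set (BondConfig (Fin n)), MeasurableSet S := fun _ => MeasurableSet.of_discrete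
  have h3 : A.card = 3 := le_antisymm hA (by omega)
  -- `A = {a₁, x, y}` with the two other relays `x ≠ y`
  have hB : (A.erase a₁).card = 2 := by rw [Finset.card_erase_of_mem ha₁, h3]
  obtain ⟨x, y, hxy, hBxy⟩ := Finset.card_eq_two.1 hB
  have hx : x ∈ A.erase a₁ := by rw [hBxy]; exact Finset.mem_insert_self _ _
  have hy : y ∈ A.erase a₁ := by rw [hBxy]; exact Finset.mem_insert_of_mem (Finset.mem_singleton_self _)
  have hxa : x ≠ a₁ := Finset.ne_of_mem_erase hx
  have hya : y ≠ a₁ := Finset.ne_of_mem_erase hy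
  have hxA : x ∈ A := Finset.mem_of_mem_erase hx
  have hyA : y ∈ A := Finset.mem_of_mem_erase hy
  have hAeq : A = ({a₁, x, y} : Finset (Fin n)) := by
    rw [← Finset.insert_erase ha₁, hBxy]
  -- worst relay in connection form: `μ(a₁↔c) ≤ μ(a↔c)` on `A`
  have hcompl : ∀ a : Fin n, (prodBernoulli w).real (openConn a c : Set (BondConfig (Fin n)))ᶜ =
      1 - (prodBernoulli w).real (openConn a c : Set (BondConfig (Fin n))) := fun a => probReal_compl_eq_one_sub (hmeas _)
  have hle : ∀ a ∈ A, (prodBernoulli w).real (openConn a₁ c) ≤ (prodBernoulli w).real (openConn a c) := by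
    intro a ha
    have := hworst a ha
    rw [hcompl, hcompl] at this
    linarith
  rw [hAeq, biUnion_openConn_three]
  rcases le_total ((prodBernoulli w).real (openConn x c)) ((prodBernoulli w).real (openConn y c)) with hxy' | hyx'
  · exact condGluing_three w o c a₁ x y hya hxy.symm (hle x hxA) hxy'
  · have hswap : (openConn o a₁ ∪ openConn o x ∪ openConn o y : Set (BondConfig (Fin n))) =
        openConn o a₁ ∪ openConn o y ∪ openConn o x := by
      rw [Set.union_assoc, Set.union_comm (openConn o x), ← Set.union_assoc]
    rw [hswap]
    exact condGluing_three w o c a₁ y x hxa hxy (hle y hyA) hyx'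

/-- **Kozma–Nitzan's Conjecture 1 for `|A| ≤ 3` (PROVED)**, in the signature of the registered conjecture
`KozmaNitzan2024_conjecture1` restricted to `A.card ≤ 3`: for every finite weighted graph, relay set `A` with at most three relays,
observer `o`, sink `c` and `t` with `t ≤ μ(a ↔ c)` on `A`:  `μ(o ↔ A) · t ≤ μ(o ↔ c)`.  (Open in print at `|A| = 3`:
Kozma–Nitzan prove `|A| = 2`, Thm 1, and the separating case, Thm 3.) [cite: KozmaNitzan2024, Conjecture 1 (p. 3), Theorem 1 (p. 7)] -/
theorem kozmaNitzan_conjecture1_card_le_three (w : Sym2 (Fin n) → unitInterval) (A : Finset (Fin n)) (o c : Fin n)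
    (hA : A.card ≤ 3) (t : ℝ) (ht : ∀ a ∈ A, t ≤ (prodBernoulli w).real (openConn a c)) :
    (prodBernoulli w).real (⋃ a ∈ A, openConn o a) * t ≤ (prodBernoulli w).real (openConn o c) := by
  set μ := prodBernoulli w with hμ
  set d : Fin n → ℝ := fun x => μ.real (openConn x c : Set (BondConfig (Fin n)))ᶜ with hd
  rcases A.eq_empty_or_nonempty with hAe | hAne
  · subst hAe
    simp only [Finset.notMem_empty, Set.iUnion_of_empty, Set.iUnion_empty, measureReal_empty, zero_mul]
    exact measureReal_nonneg
  obtain ⟨a₁, ha₁, hmax⟩ := Finset.exists_max_image A d hAne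
  exact kozmaNitzan_conjecture1_of_condGluing_at w A o c a₁ ha₁ (condGluing_card_le_three w A o c a₁ hA ha₁ hmax) t ht

end CondGluing

end Summit.CriticalPhenomena.PercolationContinuityZ3.Theorems

end
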